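import Literature.Combinatorics.Enumerative.MultivariateAperyJacobsthalRatioProofs
import Mathlib.Tactic
import HarnessLib

/-!
# Beukers 1985, Theorem 1 for the Apéry numbers — the termwise congruence at the SHIFTED argument `p^r m − 1`

Topic `Literature/Combinatorics/Enumerative`, namespace
`Literature.Combinatorics.Enumerative.AperyShiftedSupercongruenceProofs` (first of two files; the second,
`AperyShiftedSupercongruenceProofs`, discharges the named fact
`MultivariateAperyNumbers.beukers1985_supercongruence`). PROOF FILE: sorry-free theorems only — no definition,
no named fact. Sources read on the page: F. Beukers, *Some congruences for the Apéry numbers*, J. Number Theory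
**21** (1985) 141–155 [Beukers1985], Theorem 1 (p. 142, second display) «Let `m, r ∈ ℕ` and `p > 3` prime. Then
`u_{mp^r−1} ≡ u_{mp^{r−1}−1} (mod p^{3r})`» for `u_n = Σ_k C(n,k)² C(n+k,k)²`, restated as [Straub2014] (3)
«for primes `p ≥ 5`, `r ≥ 1` and positive `m`, `A(p^r m − 1) ≡ A(p^{r−1} m − 1) (mod p^{3r})`». Beukers (p. 142):
«The proof of these congruences is quite involved … It would be very nice if a more natural proof of Theorem 1
were found instead of the "brute force method" we employed.»

HONEST FRAMING (cell pub-zeta5): a classical `p`-adic supercongruence for Apéry's `ζ(3)` numbers, made a theorem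
of the tree; nothing about `ζ(5)`, no irrationality statement.

## Route (NOT the printed one): absorption onto Jacobsthal's congruence at NONNEGATIVE arguments

Write `N = p·M` (`M = p^{r−1} m`), `F(n, k) = C(n, k)² C(n + k, k)²`. The two ABSORPTION IDENTITIES
`C(M − 1, K)·M = C(M, K)·(M − K)` and `C(M + K − 1, K)·(M + K) = C(M + K, K)·M` (Mathlib
`Nat.choose_mul_succ_eq`) hold with the SAME rational factors `(M − K)/M`, `M/(M + K)` at the level
`(Mp, Kp)`, so the two unit ratios of Jacobsthal's congruence (the tree's
`Jacobsthal.exists_ratio`: `C(ap, bp)/C(a, b) ≡ 1 (mod p^{3 + v(a) + v(b) + v(a−b)})`, `p > 3`) for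
`C(Mp, Kp)/C(M, K)` and `C((M+K)p, Kp)/C(M+K, K)` become unit ratios for the SHIFTED binomials
`C(Mp − 1, Kp)/C(M − 1, K)` and `C(Mp + Kp − 1, Kp)/C(M + K − 1, K)` with exponent
`J ≥ 3 + v(M) + v(K) + min(v(M − K), v(M + K)) ≥ 3 + v(M) + v(K) + min(v(M), v(K))`. With
`e = v(F(M − 1, K)) ≥ 2 (v(M) − v(K))` (from `K·C(M + K − 1, K) = M·C(M + K − 1, K − 1)`) one checks
`J + e ≥ 3r` whenever `p^{r−1} ∣ M` (case `v(K) ≤ v(M)`: `3 + 3v(M) ≥ 3r`; case `v(K) > v(M)`: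
`4 + 3v(M) > 3r`), whence (`MultivariateAperyPrimePowerProofs.modEq_of_ratio`)

  **`F(Mp − 1, Kp) ≡ F(M − 1, K) (mod p^{3r})` for every `1 ≤ K < M`** (`shifted_term_modEq`).

No induction on the `p`-adic digit of `K` is needed (contrast [Straub2014] Lemma 5.3, whose exponent
`r + 2 min(r, s)` requires the extra factor `p^{2(r−s)}`; here the shifted binomial `C(Mp + Kp − 1, Kp)` carries
that factor itself).

* `uratio_choose_pred`, `uratio_choose_add_pred` — the two absorbed Jacobsthal ratios;
* `pow_sub_dvd_choose_add_pred` — `p^{v(M) − v(K)} ∣ C(M + K − 1, K)`;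
* **`shifted_term_modEq`** — the termwise congruence above.
-/

open Finset

namespace Literature.Combinatorics.Enumerative.AperyShiftedSupercongruenceProofs

open Literature.NumberTheory.Congruences (Jacobsthal.exists_ratio)
open MultivariateAperyPrimePowerProofs (modEq_of_ratio)

section Ratio

variable {p : ℕ} [hp : Fact p.Prime]

/-- Unit-ratio relations multiply. [folklore] -/
private theorem uratio_mul {N A A' B B' : ℕ}
    (hA : ∃ x y : ℕ, ¬ p ∣ y ∧ y * A = x * A' ∧ x ≡ y [MOD p ^ N])
    (hB : ∃ x y : ℕ, ¬ p ∣ y ∧ y * B = x * B' ∧ x ≡ y [MOD p ^ N]) :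
    ∃ x y : ℕ, ¬ p ∣ y ∧ y * (A * B) = x * (A' * B') ∧ x ≡ y [MOD p ^ N] := by
  obtain ⟨x₁, y₁, hy₁, h₁, hm₁⟩ := hA
  obtain ⟨x₂, y₂, hy₂, h₂, hm₂⟩ := hB
  refine ⟨x₁ * x₂, y₁ * y₂, fun h => ?_, ?_, hm₁.mul hm₂⟩
  · rcases (Nat.Prime.dvd_mul hp.out).mp h with h | h
    · exact hy₁ h
    · exact hy₂ h
  · calc y₁ * y₂ * (A * B) = (y₁ * A) * (y₂ * B) := by ring
      _ = (x₁ * A') * (x₂ * B') := by rw [h₁, h₂]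
      _ = x₁ * x₂ * (A' * B') := by ring

/-- Unit-ratio relations square. [folklore] -/
private theorem uratio_sq {N A A' : ℕ}
    (hA : ∃ x y : ℕ, ¬ p ∣ y ∧ y * A = x * A' ∧ x ≡ y [MOD p ^ N]) :
    ∃ x y : ℕ, ¬ p ∣ y ∧ y * A ^ 2 = x * A' ^ 2 ∧ x ≡ y [MOD p ^ N] := by
  simpa only [sq] using uratio_mul hA hA

omit hp in
/-- Unit-ratio relations weaken to smaller moduli. [folklore] -/
private theorem uratio_of_le {N N' A A' : ℕ} (hN : N' ≤ N)
    (hA : ∃ x y : ℕ, ¬ p ∣ y ∧ y * A = x * A' ∧ x ≡ y [MOD p ^ N]) :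
    ∃ x y : ℕ, ¬ p ∣ y ∧ y * A = x * A' ∧ x ≡ y [MOD p ^ N'] := by
  obtain ⟨x, y, hy, h, hm⟩ := hA
  exact ⟨x, y, hy, h, hm.of_dvd (pow_dvd_pow p hN)⟩

/-- If `p^t ∣ a ≠ 0` then `t ≤ v_p(a)`. [folklore] -/
private theorem le_padicValNat_of_pow_dvd' {t a : ℕ} (ha : a ≠ 0) (h : p ^ t ∣ a) :
    t ≤ padicValNat p a :=
  (padicValNat_dvd_iff_le ha).mp h

/-- **First absorbed Jacobsthal ratio.** For a prime `p > 3`, `M ≥ 1` and all `K`: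
`C(Mp − 1, Kp)/C(M − 1, K) ≡ 1 (mod p^{3 + v(M) + v(K) + v(M − K)})` as a unit ratio — Jacobsthal's ratio for
`C(Mp, Kp)/C(M, K)` multiplied through by the common factor `(M − K)/M` of the absorption identity
`C(n − 1, k)·n = C(n, k)·(n − k)` at both levels. [cite: Beukers1985, Theorem 1 (second congruence)] -/
theorem uratio_choose_pred (h3 : 3 < p) {M : ℕ} (hM : 1 ≤ M) (K : ℕ) :
    ∃ x y : ℕ, ¬ p ∣ y ∧ y * (M * p - 1).choose (K * p) = x * (M - 1).choose K ∧
      x ≡ y [MOD p ^ (3 + padicValNat p M + padicValNat p K + padicValNat p (M - K))] := by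
  have hp' := hp.out
  obtain ⟨x, y, hy, hxy, hmod⟩ := Jacobsthal.exists_ratio (p := p) h3 M K
  refine ⟨x, y, hy, ?_, hmod⟩
  have h1 : (M - 1).choose K * M = M.choose K * (M - K) := by
    have := Nat.choose_mul_succ_eq (M - 1) K
    rwa [Nat.sub_add_cancel hM] at this
  have hMp : 1 ≤ M * p := Nat.mul_pos hM hp'.pos
  have h2 : (M * p - 1).choose (K * p) * (M * p) = (M * p).choose (K * p) * ((M - K) * p) := by
    have := Nat.choose_mul_succ_eq (M * p - 1) (K * p)
    rwa [Nat.sub_add_cancel hMp, ← Nat.sub_mul] at this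
  refine Nat.eq_of_mul_eq_mul_right hMp ?_
  calc y * (M * p - 1).choose (K * p) * (M * p)
      = y * ((M * p - 1).choose (K * p) * (M * p)) := by ring
    _ = y * ((M * p).choose (K * p) * ((M - K) * p)) := by rw [h2]
    _ = (y * (M * p).choose (K * p)) * ((M - K) * p) := by ring
    _ = (x * M.choose K) * ((M - K) * p) := by rw [hxy]
    _ = x * (M.choose K * (M - K)) * p := by ring
    _ = x * ((M - 1).choose K * M) * p := by rw [h1]
    _ = x * (M - 1).choose K * (M * p) := by ring

/-- **Second absorbed Jacobsthal ratio.** For a prime `p > 3`, `M ≥ 1` and all `K`: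
`C(Mp + Kp − 1, Kp)/C(M + K − 1, K) ≡ 1 (mod p^{3 + v(M + K) + v(K) + v(M)})` as a unit ratio — Jacobsthal's
ratio for `C((M+K)p, Kp)/C(M+K, K)` multiplied through by the common factor `M/(M + K)` of
`C(M + K − 1, K)·(M + K) = C(M + K, K)·M` at both levels. [cite: Beukers1985, Theorem 1 (second congruence)] -/
theorem uratio_choose_add_pred (h3 : 3 < p) {M : ℕ} (hM : 1 ≤ M) (K : ℕ) :
    ∃ x y : ℕ, ¬ p ∣ y ∧ y * (M * p + K * p - 1).choose (K * p) = x * (M + K - 1).choose K ∧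
      x ≡ y [MOD p ^ (3 + padicValNat p (M + K) + padicValNat p K + padicValNat p M)] := by
  have hp' := hp.out
  obtain ⟨x, y, hy, hxy, hmod⟩ := Jacobsthal.exists_ratio (p := p) h3 (M + K) K
  rw [Nat.add_sub_cancel] at hmod
  refine ⟨x, y, hy, ?_, hmod⟩
  have hMK : 1 ≤ M + K := le_add_right hM
  have h1 : (M + K - 1).choose K * (M + K) = (M + K).choose K * M := by
    have := Nat.choose_mul_succ_eq (M + K - 1) K
    rwa [Nat.sub_add_cancel hMK, Nat.add_sub_cancel] at this
  have hMKp : 1 ≤ (M + K) * p := Nat.mul_pos hMK hp'.pos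
  have hsub : (M + K) * p - K * p = M * p := by rw [← Nat.sub_mul, Nat.add_sub_cancel]
  have h2 : ((M + K) * p - 1).choose (K * p) * ((M + K) * p) = ((M + K) * p).choose (K * p) * (M * p) := by
    have := Nat.choose_mul_succ_eq ((M + K) * p - 1) (K * p)
    rwa [Nat.sub_add_cancel hMKp, hsub] at this
  rw [show M * p + K * p - 1 = (M + K) * p - 1 by rw [Nat.add_mul]]
  refine Nat.eq_of_mul_eq_mul_right hMKp ?_
  calc y * ((M + K) * p - 1).choose (K * p) * ((M + K) * p)
      = y * (((M + K) * p - 1).choose (K * p) * ((M + K) * p)) := by ring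
    _ = y * (((M + K) * p).choose (K * p) * (M * p)) := by rw [h2]
    _ = (y * ((M + K) * p).choose (K * p)) * (M * p) := by ring
    _ = (x * (M + K).choose K) * (M * p) := by rw [hxy]
    _ = x * ((M + K).choose K * M) * p := by ring
    _ = x * ((M + K - 1).choose K * (M + K)) * p := by rw [h1]
    _ = x * (M + K - 1).choose K * ((M + K) * p) := by ring

/-- **`p^{v(M) − v(K)} ∣ C(M + K − 1, K)`** for `M, K ≥ 1`, from `K·C(M + K − 1, K) = M·C(M + K − 1, K − 1)`
(Mathlib `Nat.choose_succ_right_eq`): the shifted binomial `C(N − 1 + K, K) = (N/(N+K))·C(N + K, K)` keeps the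
`p`-power that `C(N, K)` loses under the shift. [cite: Beukers1985, Theorem 1 (second congruence)] -/
theorem pow_sub_dvd_choose_add_pred {M K : ℕ} (hM : 1 ≤ M) (hK : 1 ≤ K) :
    p ^ (padicValNat p M - padicValNat p K) ∣ (M + K - 1).choose K := by
  have hid : (M + K - 1).choose K * K = (M + K - 1).choose (K - 1) * M := by
    have := Nat.choose_succ_right_eq (M + K - 1) (K - 1)
    rwa [Nat.sub_add_cancel hK, show M + K - 1 - (K - 1) = M by omega] at this
  have hC : (M + K - 1).choose K ≠ 0 := (Nat.choose_pos (by omega)).ne'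
  have hC' : (M + K - 1).choose (K - 1) ≠ 0 := (Nat.choose_pos (by omega)).ne'
  have hv := congrArg (padicValNat p) hid
  rw [padicValNat.mul hC (by omega), padicValNat.mul hC' (by omega)] at hv
  rw [padicValNat_dvd_iff_le hC]
  omega

/-- **The termwise congruence at the shifted argument** (the heart of this route to [Beukers1985] Theorem 1):
for a prime `p > 3`, `r ≥ 1`, `p^{r−1} ∣ M` and `1 ≤ K < M`,
`C(Mp − 1, Kp)² C(Mp + Kp − 1, Kp)² ≡ C(M − 1, K)² C(M + K − 1, K)² (mod p^{3r})`, i.e.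
`F(N − 1, Kp) ≡ F(N/p − 1, K)` for the Apéry summand `F(n, k) = C(n, k)² C(n + k, k)²`, `N = Mp`.
Exponent count: unit ratio modulo `p^J`, `J = 3 + v(M) + v(K) + min(v(M), v(K))`, and
`p^{2(v(M) − v(K))} ∣ F(M − 1, K)`; `J + 2(v(M) − v(K))⁺ ≥ 3r`.
[cite: Beukers1985, Theorem 1 (second congruence)] [cite: Straub2014, (3)] -/
theorem shifted_term_modEq (h3 : 3 < p) {r M K : ℕ} (hr : 1 ≤ r) (hMr : p ^ (r - 1) ∣ M)
    (hK : 1 ≤ K) (hKM : K < M) :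
    (((M * p - 1).choose (K * p) ^ 2 * (M * p + K * p - 1).choose (K * p) ^ 2 : ℕ) : ℤ) ≡
      (((M - 1).choose K ^ 2 * (M + K - 1).choose K ^ 2 : ℕ) : ℤ) [ZMOD (p : ℤ) ^ (3 * r)] := by
  have hM : 1 ≤ M := by omega
  have hM0 : M ≠ 0 := by omega
  have hK0 : K ≠ 0 := by omega
  set a := padicValNat p M with ha
  set t := padicValNat p K with ht
  have har : r - 1 ≤ a := le_padicValNat_of_pow_dvd' hM0 hMr
  -- `p^{min a t}` divides `M`, `K`, hence `M − K` and `M + K`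
  have hpa : p ^ min a t ∣ M := (pow_dvd_pow p (min_le_left a t)).trans pow_padicValNat_dvd
  have hpt : p ^ min a t ∣ K := (pow_dvd_pow p (min_le_right a t)).trans pow_padicValNat_dvd
  have hvsub : min a t ≤ padicValNat p (M - K) :=
    le_padicValNat_of_pow_dvd' (by omega) (Nat.dvd_sub hpa hpt)
  have hvadd : min a t ≤ padicValNat p (M + K) :=
    le_padicValNat_of_pow_dvd' (by omega) (dvd_add hpa hpt)
  -- the two absorbed unit ratios at the common modulus `p^J`
  have h1 := uratio_of_le (N' := 3 + a + t + min a t) (by omega) (uratio_choose_pred (p := p) h3 hM K)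
  have h2 := uratio_of_le (N' := 3 + a + t + min a t) (by omega) (uratio_choose_add_pred (p := p) h3 hM K)
  have hall := uratio_mul (uratio_sq h1) (uratio_sq h2)
  -- the `p`-power kept by the lower term
  have hdiv : p ^ (2 * (a - t)) ∣ (M - 1).choose K ^ 2 * (M + K - 1).choose K ^ 2 := by
    have h := pow_dvd_pow_of_dvd (pow_sub_dvd_choose_add_pred (p := p) hM hK) 2
    rw [← pow_mul, mul_comm] at h
    exact h.mul_left _
  have hmod := modEq_of_ratio hall hdiv
  refine Int.ModEq.of_dvd (pow_dvd_pow (p : ℤ) ?_) hmod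
  omega

end Ratio

end Literature.Combinatorics.Enumerative.AperyShiftedSupercongruenceProofs
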